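import Summits.Ventures.LatticeQCDFlow.Scoring.SpecialUnitaryLaplace
import Summits.Ventures.LatticeQCDFlow.Scoring.GaussVandermondeSecondMoment
import HarnessLib

/-!
# The second moment of the `SU(N)` Gaussian–Vandermonde law on the hyperplane: `∫ (Σ_b φ_b(ψ)²) e^{−Σφ_b(ψ)²/2} Π_{j≺k}(φ_j(ψ) − φ_k(ψ))² dψ = (N² − 1) · M^{SU}_N`, by scaling

HONEST FRAMING: exact (Metropolis-corrected) sampling algorithms for lattice gauge theory;
figures of merit are autocorrelation/cost numbers at stated couplings and volumes; no
continuum-physics claim.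

Venture `LatticeQCDFlow` (cell pub-lqcd), sub-topic `Scoring`; FANOUT row 5 (`s0-sun-a`), GEN-20.
NEW WORK of the cell (placement rule).  The `SU(N)` twin of `GaussVandermondeSecondMoment` (input of the one-loop law
of the `SU(N)` plaquette, `β(1 − P_N(β)) → (N²−1)/(2N)`): in GEN-17's free phases `ψ : {i ≠ i₀} → ℝ`, `φ_{i₀} = −Σψ`,
with `M^{SU} = ∫ e^{−Σ_bφ_b(ψ)²/2} Π_{j≺k}(φ_j(ψ) − φ_k(ψ))² dψ` (GEN-20 `SpecialUnitaryLaplace`):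

* **`integral_suGaussVandermonde_scale`** — `∫ e^{−tΣ_bφ_b(ψ)²/2} Π(φ_j(ψ) − φ_k(ψ))² dψ = M^{SU} / √t^{N²−1}` (`t > 0`);
* **`integral_normSq_suGaussVandermonde`** — `∫ (Σ_bφ_b(ψ)²) e^{−Σφ_b(ψ)²/2} Π(φ_j(ψ) − φ_k(ψ))² dψ = (N² − 1) · M^{SU}`
  (differentiation under the integral sign at `t = 1`; `N² − 1 = dim SU(N)`).

No `def`, nothing cited as a fact, 0 sorry.
-/

noncomputable section

open Real MeasureTheory Filter Topology Finset
open Literature.RepresentationTheory.CompactGroups.WeylIntegration (OD enum)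

namespace Summit.Ventures.LatticeQCDFlow.Scoring

section SU2nd

variable {n : Type*} [Fintype n] [DecidableEq n] (i₀ : n)

/-- `Σ_k ψ_k² ≤ Σ_b φ_b(ψ)²` (the free phases are among the phases). -/
theorem sum_sq_le_sum_phase_sq (ψ : {i : n // i ≠ i₀} → ℝ) :
    ∑ k, ψ k ^ 2 ≤ ∑ b : n, (if h : b = i₀ then -∑ k, ψ k else ψ ⟨b, h⟩ : ℝ) ^ 2 := by
  rw [← Finset.add_sum_erase _ _ (Finset.mem_univ i₀),
    Finset.sum_subtype (Finset.univ.erase i₀) (p := fun i : n => i ≠ i₀) (by simp)]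
  have h : ∑ k : {i : n // i ≠ i₀}, (if h : (k : n) = i₀ then -∑ k, ψ k else ψ ⟨k, h⟩ : ℝ) ^ 2 = ∑ k, ψ k ^ 2 :=
    Finset.sum_congr rfl fun k _ => by rw [dif_neg k.2]
  rw [h]
  nlinarith [sq_nonneg (if h : i₀ = i₀ then -∑ k, ψ k else ψ ⟨i₀, h⟩ : ℝ)]

/-- `Σ_b φ_b(ψ)² ≤ (1 + |m|) Π_k (1 + ψ_k²)`. -/
theorem sum_phase_sq_le (ψ : {i : n // i ≠ i₀} → ℝ) :
    ∑ b : n, (if h : b = i₀ then -∑ k, ψ k else ψ ⟨b, h⟩ : ℝ) ^ 2 ≤ (1 + Fintype.card {i : n // i ≠ i₀}) * ∏ k : {i : n // i ≠ i₀}, (1 + ψ k ^ 2) := by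
  rw [← Finset.add_sum_erase _ _ (Finset.mem_univ i₀),
    Finset.sum_subtype (Finset.univ.erase i₀) (p := fun i : n => i ≠ i₀) (by simp), dif_pos rfl]
  have h : ∑ k : {i : n // i ≠ i₀}, (if h : (k : n) = i₀ then -∑ k, ψ k else ψ ⟨k, h⟩ : ℝ) ^ 2 = ∑ k, ψ k ^ 2 :=
    Finset.sum_congr rfl fun k _ => by rw [dif_neg k.2]
  rw [h, neg_sq]
  have hCS : (∑ k, ψ k) ^ 2 ≤ Fintype.card {i : n // i ≠ i₀} * ∑ k, ψ k ^ 2 := by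
    have h := sq_sum_le_card_mul_sum_sq (s := (Finset.univ : Finset {i : n // i ≠ i₀})) (f := fun k => ψ k)
    simpa using h
  have hP := sum_sq_le_prod_one_add_sq ψ
  have hm : (0 : ℝ) ≤ Fintype.card {i : n // i ≠ i₀} := Nat.cast_nonneg _
  have h0 : 0 ≤ ∑ k, ψ k ^ 2 := Finset.sum_nonneg fun k _ => sq_nonneg _
  nlinarith [mul_le_mul_of_nonneg_left hP hm]

/-- **Scaling law on the hyperplane**: `∫ e^{−tΣφ_b(ψ)²/2} Π(φ_j(ψ) − φ_k(ψ))² dψ = M^{SU} / √t^{N²−1}` (`t > 0`). -/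
theorem integral_suGaussVandermonde_scale {t : ℝ} (ht : 0 < t) :
    ∫ ψ : {i : n // i ≠ i₀} → ℝ, Real.exp (∑ b : n, -(t * (if h : b = i₀ then -∑ k, ψ k else ψ ⟨b, h⟩ : ℝ) ^ 2 / 2)) *
        ∏ p : OD n, ((if h : p.1.1 = i₀ then -∑ k, ψ k else ψ ⟨p.1.1, h⟩ : ℝ) - (if h : p.1.2 = i₀ then -∑ k, ψ k else ψ ⟨p.1.2, h⟩ : ℝ)) ^ 2
      = (∫ ψ : {i : n // i ≠ i₀} → ℝ, Real.exp (∑ b : n, -((if h : b = i₀ then -∑ k, ψ k else ψ ⟨b, h⟩ : ℝ) ^ 2 / 2)) *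
          ∏ p : OD n, ((if h : p.1.1 = i₀ then -∑ k, ψ k else ψ ⟨p.1.1, h⟩ : ℝ) - (if h : p.1.2 = i₀ then -∑ k, ψ k else ψ ⟨p.1.2, h⟩ : ℝ)) ^ 2) / √t ^ (Fintype.card n ^ 2 - 1) := by
  have hs : 0 < √t := Real.sqrt_pos.2 ht
  set F : ({i : n // i ≠ i₀} → ℝ) → ℝ := fun ψ => Real.exp (∑ b : n, -((if h : b = i₀ then -∑ k, ψ k else ψ ⟨b, h⟩ : ℝ) ^ 2 / 2)) *
    ∏ p : OD n, ((if h : p.1.1 = i₀ then -∑ k, ψ k else ψ ⟨p.1.1, h⟩ : ℝ) - (if h : p.1.2 = i₀ then -∑ k, ψ k else ψ ⟨p.1.2, h⟩ : ℝ)) ^ 2 with hF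
  have hpt : ∀ ψ : {i : n // i ≠ i₀} → ℝ, F (√t • ψ) = √t ^ (2 * Fintype.card (OD n)) *
      (Real.exp (∑ b : n, -(t * (if h : b = i₀ then -∑ k, ψ k else ψ ⟨b, h⟩ : ℝ) ^ 2 / 2)) * ∏ p : OD n, ((if h : p.1.1 = i₀ then -∑ k, ψ k else ψ ⟨p.1.1, h⟩ : ℝ) - (if h : p.1.2 = i₀ then -∑ k, ψ k else ψ ⟨p.1.2, h⟩ : ℝ)) ^ 2) := by
    intro ψ
    simp only [hF, phase_smul]
    have h1 : ∑ b : n, -((√t * (if h : b = i₀ then -∑ k, ψ k else ψ ⟨b, h⟩ : ℝ)) ^ 2 / 2) = ∑ b : n, -(t * (if h : b = i₀ then -∑ k, ψ k else ψ ⟨b, h⟩ : ℝ) ^ 2 / 2) := by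
      refine Finset.sum_congr rfl fun b _ => ?_
      rw [mul_pow, Real.sq_sqrt ht.le]
    have h2 : ∏ p : OD n, (√t * (if h : p.1.1 = i₀ then -∑ k, ψ k else ψ ⟨p.1.1, h⟩ : ℝ) - √t * (if h : p.1.2 = i₀ then -∑ k, ψ k else ψ ⟨p.1.2, h⟩ : ℝ)) ^ 2 = √t ^ (2 * Fintype.card (OD n)) *
        ∏ p : OD n, ((if h : p.1.1 = i₀ then -∑ k, ψ k else ψ ⟨p.1.1, h⟩ : ℝ) - (if h : p.1.2 = i₀ then -∑ k, ψ k else ψ ⟨p.1.2, h⟩ : ℝ)) ^ 2 := by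
      have hc : ∏ _p : OD n, √t ^ 2 = √t ^ (2 * Fintype.card (OD n)) := by
        rw [Finset.prod_const, Finset.card_univ, ← pow_mul, mul_comm]
      rw [← hc, ← Finset.prod_mul_distrib]
      exact Finset.prod_congr rfl fun p _ => by ring
    rw [h1, h2]
    ring
  have hcomp := Measure.integral_comp_smul volume F (√t)
  rw [Module.finrank_fintype_fun_eq_card, smul_eq_mul] at hcomp
  simp_rw [hpt] at hcomp
  rw [integral_const_mul] at hcomp
  have hcard : Fintype.card n ^ 2 - 1 = Fintype.card {i : n // i ≠ i₀} + 2 * Fintype.card (OD n) :=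
    (card_ne_add_two_mul_card_OD i₀).symm
  have habs : |(√t ^ Fintype.card {i : n // i ≠ i₀})⁻¹| = (√t ^ Fintype.card {i : n // i ≠ i₀})⁻¹ :=
    abs_of_pos (by positivity)
  rw [habs] at hcomp
  rw [hcard, pow_add, eq_div_iff (by positivity)]
  calc (∫ ψ : {i : n // i ≠ i₀} → ℝ, Real.exp (∑ b : n, -(t * (if h : b = i₀ then -∑ k, ψ k else ψ ⟨b, h⟩ : ℝ) ^ 2 / 2)) * ∏ p : OD n, ((if h : p.1.1 = i₀ then -∑ k, ψ k else ψ ⟨p.1.1, h⟩ : ℝ) - (if h : p.1.2 = i₀ then -∑ k, ψ k else ψ ⟨p.1.2, h⟩ : ℝ)) ^ 2) *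
        (√t ^ Fintype.card {i : n // i ≠ i₀} * √t ^ (2 * Fintype.card (OD n)))
      = (√t ^ (2 * Fintype.card (OD n)) * ∫ ψ : {i : n // i ≠ i₀} → ℝ, Real.exp (∑ b : n, -(t * (if h : b = i₀ then -∑ k, ψ k else ψ ⟨b, h⟩ : ℝ) ^ 2 / 2)) *
          ∏ p : OD n, ((if h : p.1.1 = i₀ then -∑ k, ψ k else ψ ⟨p.1.1, h⟩ : ℝ) - (if h : p.1.2 = i₀ then -∑ k, ψ k else ψ ⟨p.1.2, h⟩ : ℝ)) ^ 2) * √t ^ Fintype.card {i : n // i ≠ i₀} := by ring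
    _ = (√t ^ Fintype.card {i : n // i ≠ i₀})⁻¹ * (∫ ψ, F ψ) * √t ^ Fintype.card {i : n // i ≠ i₀} := by rw [hcomp]
    _ = ∫ ψ, F ψ := by field_simp

/-- **`∫ (Σ_bφ_b(ψ)²) e^{−Σφ_b(ψ)²/2} Π(φ_j(ψ) − φ_k(ψ))² dψ = (N² − 1) · M^{SU}`** (`dim SU(N) = N² − 1`). -/
theorem integral_normSq_suGaussVandermonde :
    ∫ ψ : {i : n // i ≠ i₀} → ℝ, (∑ b : n, (if h : b = i₀ then -∑ k, ψ k else ψ ⟨b, h⟩ : ℝ) ^ 2) * (Real.exp (∑ b : n, -((if h : b = i₀ then -∑ k, ψ k else ψ ⟨b, h⟩ : ℝ) ^ 2 / 2)) *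
        ∏ p : OD n, ((if h : p.1.1 = i₀ then -∑ k, ψ k else ψ ⟨p.1.1, h⟩ : ℝ) - (if h : p.1.2 = i₀ then -∑ k, ψ k else ψ ⟨p.1.2, h⟩ : ℝ)) ^ 2)
      = ((Fintype.card n : ℝ) ^ 2 - 1) * ∫ ψ : {i : n // i ≠ i₀} → ℝ, Real.exp (∑ b : n, -((if h : b = i₀ then -∑ k, ψ k else ψ ⟨b, h⟩ : ℝ) ^ 2 / 2)) *
        ∏ p : OD n, ((if h : p.1.1 = i₀ then -∑ k, ψ k else ψ ⟨p.1.1, h⟩ : ℝ) - (if h : p.1.2 = i₀ then -∑ k, ψ k else ψ ⟨p.1.2, h⟩ : ℝ)) ^ 2 := by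
  set M : ℝ := ∫ ψ : {i : n // i ≠ i₀} → ℝ, Real.exp (∑ b : n, -((if h : b = i₀ then -∑ k, ψ k else ψ ⟨b, h⟩ : ℝ) ^ 2 / 2)) *
    ∏ p : OD n, ((if h : p.1.1 = i₀ then -∑ k, ψ k else ψ ⟨p.1.1, h⟩ : ℝ) - (if h : p.1.2 = i₀ then -∑ k, ψ k else ψ ⟨p.1.2, h⟩ : ℝ)) ^ 2 with hM
  set F : ℝ → ({i : n // i ≠ i₀} → ℝ) → ℝ := fun t ψ => Real.exp (∑ b : n, -(t * (if h : b = i₀ then -∑ k, ψ k else ψ ⟨b, h⟩ : ℝ) ^ 2 / 2)) *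
    ∏ p : OD n, ((if h : p.1.1 = i₀ then -∑ k, ψ k else ψ ⟨p.1.1, h⟩ : ℝ) - (if h : p.1.2 = i₀ then -∑ k, ψ k else ψ ⟨p.1.2, h⟩ : ℝ)) ^ 2 with hF
  set F' : ℝ → ({i : n // i ≠ i₀} → ℝ) → ℝ := fun t ψ => -((∑ b : n, (if h : b = i₀ then -∑ k, ψ k else ψ ⟨b, h⟩ : ℝ) ^ 2) / 2) *
    (Real.exp (∑ b : n, -(t * (if h : b = i₀ then -∑ k, ψ k else ψ ⟨b, h⟩ : ℝ) ^ 2 / 2)) * ∏ p : OD n, ((if h : p.1.1 = i₀ then -∑ k, ψ k else ψ ⟨p.1.1, h⟩ : ℝ) - (if h : p.1.2 = i₀ then -∑ k, ψ k else ψ ⟨p.1.2, h⟩ : ℝ)) ^ 2) with hF'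
  have hphc : ∀ b : n, Continuous fun ψ : {i : n // i ≠ i₀} → ℝ => (if h : b = i₀ then -∑ k, ψ k else ψ ⟨b, h⟩ : ℝ) := fun b => continuous_ext_apply i₀ b
  have hcont : ∀ t, Continuous (F t) := fun t => by
    simp only [hF]
    refine (Real.continuous_exp.comp (continuous_finsetSum _ fun b _ => ((continuous_const.mul
      ((hphc b).pow 2)).div_const _).neg)).mul (continuous_finsetProd _ fun p _ => ((hphc _).sub (hphc _)).pow 2)
  have hcont' : ∀ t, Continuous (F' t) := fun t => by
    simp only [hF']
    exact (((continuous_finsetSum _ fun b _ => (hphc b).pow 2).div_const _).neg).mul (hcont t)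
  have hderiv : ∀ ψ : {i : n // i ≠ i₀} → ℝ, ∀ t : ℝ, HasDerivAt (fun s => F s ψ) (F' t ψ) t := by
    intro ψ t
    simp only [hF, hF']
    have h1 : HasDerivAt (fun s : ℝ => ∑ b : n, -(s * (if h : b = i₀ then -∑ k, ψ k else ψ ⟨b, h⟩ : ℝ) ^ 2 / 2)) (-((∑ b : n, (if h : b = i₀ then -∑ k, ψ k else ψ ⟨b, h⟩ : ℝ) ^ 2) / 2)) t := by
      have e : (fun s : ℝ => ∑ b : n, -(s * (if h : b = i₀ then -∑ k, ψ k else ψ ⟨b, h⟩ : ℝ) ^ 2 / 2)) = fun s => s * ∑ b : n, -((if h : b = i₀ then -∑ k, ψ k else ψ ⟨b, h⟩ : ℝ) ^ 2 / 2) := by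
        funext s; rw [Finset.mul_sum]; exact Finset.sum_congr rfl fun b _ => by ring
      have hK : ∑ b : n, -((if h : b = i₀ then -∑ k, ψ k else ψ ⟨b, h⟩ : ℝ) ^ 2 / 2) = -((∑ b : n, (if h : b = i₀ then -∑ k, ψ k else ψ ⟨b, h⟩ : ℝ) ^ 2) / 2) := by
        rw [Finset.sum_neg_distrib, Finset.sum_div]
      rw [e, ← hK]
      have h := (hasDerivAt_id' t).mul_const (∑ b : n, -((if h : b = i₀ then -∑ k, ψ k else ψ ⟨b, h⟩ : ℝ) ^ 2 / 2))
      rwa [one_mul] at h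
    have h2 := h1.exp.mul_const (∏ p : OD n, ((if h : p.1.1 = i₀ then -∑ k, ψ k else ψ ⟨p.1.1, h⟩ : ℝ) - (if h : p.1.2 = i₀ then -∑ k, ψ k else ψ ⟨p.1.2, h⟩ : ℝ)) ^ 2)
    refine h2.congr_deriv ?_
    ring
  -- domination for `t ∈ (1/2, 3/2)`
  have hbound : ∀ ψ : {i : n // i ≠ i₀} → ℝ, ∀ t ∈ Set.Ioo (1 / 2 : ℝ) (3 / 2), ‖F' t ψ‖
      ≤ ((1 + Fintype.card {i : n // i ≠ i₀}) * (4 * Fintype.card {i : n // i ≠ i₀}) ^ Fintype.card (OD n)) *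
        ∏ k : {i : n // i ≠ i₀}, (Real.exp (-(2 / π ^ 2 * ψ k ^ 2)) * (1 + ψ k ^ 2) ^ (Fintype.card (OD n) + 1)) := by
    intro ψ t ht
    simp only [hF', Real.norm_eq_abs]
    rw [abs_mul, abs_neg, abs_of_nonneg (by positivity), abs_of_nonneg (mul_nonneg (Real.exp_nonneg _)
      (Finset.prod_nonneg fun p _ => sq_nonneg _))]
    have hexp : Real.exp (∑ b : n, -(t * (if h : b = i₀ then -∑ k, ψ k else ψ ⟨b, h⟩ : ℝ) ^ 2 / 2)) ≤ ∏ k : {i : n // i ≠ i₀}, Real.exp (-(2 / π ^ 2 * ψ k ^ 2)) := by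
      rw [← Real.exp_sum]
      refine Real.exp_le_exp.2 ?_
      have hπ : 2 / π ^ 2 ≤ 1 / 4 := by
        rw [div_le_div_iff₀ (by positivity) (by norm_num)]
        nlinarith [Real.pi_gt_three]
      have hQ := sum_sq_le_sum_phase_sq i₀ ψ
      have e1 : ∑ b : n, -(t * (if h : b = i₀ then -∑ k, ψ k else ψ ⟨b, h⟩ : ℝ) ^ 2 / 2) = -(t / 2) * ∑ b : n, (if h : b = i₀ then -∑ k, ψ k else ψ ⟨b, h⟩ : ℝ) ^ 2 := by
        rw [Finset.mul_sum]; exact Finset.sum_congr rfl fun b _ => by ring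
      have e2 : ∑ k : {i : n // i ≠ i₀}, -(2 / π ^ 2 * ψ k ^ 2) = -(2 / π ^ 2) * ∑ k, ψ k ^ 2 := by
        rw [Finset.mul_sum]; exact Finset.sum_congr rfl fun k _ => by ring
      rw [e1, e2]
      have h0 : 0 ≤ ∑ k, ψ k ^ 2 := Finset.sum_nonneg fun k _ => sq_nonneg _
      have hS0 : 0 ≤ ∑ b : n, (if h : b = i₀ then -∑ k, ψ k else ψ ⟨b, h⟩ : ℝ) ^ 2 := Finset.sum_nonneg fun b _ => sq_nonneg _
      nlinarith [ht.1, mul_le_mul_of_nonneg_left hQ (show (0:ℝ) ≤ t/2 by linarith [ht.1])]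
    have hmain := mul_prod_le_suBound i₀ ψ hexp (fun p => sq_nonneg _) (fun p => le_rfl)
    have hsum : (∑ b : n, (if h : b = i₀ then -∑ k, ψ k else ψ ⟨b, h⟩ : ℝ) ^ 2) / 2 ≤ (1 + Fintype.card {i : n // i ≠ i₀}) * ∏ k : {i : n // i ≠ i₀}, (1 + ψ k ^ 2) := by
      have h := sum_phase_sq_le i₀ ψ
      have h0 : 0 ≤ ∑ b : n, (if h : b = i₀ then -∑ k, ψ k else ψ ⟨b, h⟩ : ℝ) ^ 2 := Finset.sum_nonneg fun b _ => sq_nonneg _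
      linarith
    calc (∑ b : n, (if h : b = i₀ then -∑ k, ψ k else ψ ⟨b, h⟩ : ℝ) ^ 2) / 2 * (Real.exp (∑ b : n, -(t * (if h : b = i₀ then -∑ k, ψ k else ψ ⟨b, h⟩ : ℝ) ^ 2 / 2)) * ∏ p : OD n, ((if h : p.1.1 = i₀ then -∑ k, ψ k else ψ ⟨p.1.1, h⟩ : ℝ) - (if h : p.1.2 = i₀ then -∑ k, ψ k else ψ ⟨p.1.2, h⟩ : ℝ)) ^ 2)
        ≤ ((1 + Fintype.card {i : n // i ≠ i₀}) * ∏ k : {i : n // i ≠ i₀}, (1 + ψ k ^ 2)) *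
          ((4 * Fintype.card {i : n // i ≠ i₀}) ^ Fintype.card (OD n) *
            ∏ k : {i : n // i ≠ i₀}, (Real.exp (-(2 / π ^ 2 * ψ k ^ 2)) * (1 + ψ k ^ 2) ^ Fintype.card (OD n))) :=
          mul_le_mul hsum hmain (mul_nonneg (Real.exp_nonneg _) (Finset.prod_nonneg fun p _ => sq_nonneg _))
            (by positivity)
      _ = ((1 + Fintype.card {i : n // i ≠ i₀}) * (4 * Fintype.card {i : n // i ≠ i₀}) ^ Fintype.card (OD n)) *
          ∏ k : {i : n // i ≠ i₀}, (Real.exp (-(2 / π ^ 2 * ψ k ^ 2)) * (1 + ψ k ^ 2) ^ (Fintype.card (OD n) + 1)) := by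
          rw [show ∀ a b c d : ℝ, (a * b) * (c * d) = (a * c) * (b * d) from fun a b c d => by ring, ← Finset.prod_mul_distrib]
          congr 1
          exact Finset.prod_congr rfl fun k _ => by ring
  have hint1 : Integrable (F 1) := by
    refine Integrable.mono' (integrable_suBound i₀) (hcont 1).aestronglyMeasurable (Eventually.of_forall fun ψ => ?_)
    rw [Real.norm_eq_abs, abs_of_nonneg (mul_nonneg (Real.exp_nonneg _) (Finset.prod_nonneg fun p _ => sq_nonneg _))]
    simp only [one_mul]
    refine mul_prod_le_suBound i₀ ψ ?_ (fun p => sq_nonneg _) (fun p => le_rfl)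
    rw [← Real.exp_sum]
    refine Real.exp_le_exp.2 ?_
    have hQ := sum_sq_le_sum_phase_sq i₀ ψ
    have e1 : ∑ b : n, -((if h : b = i₀ then -∑ k, ψ k else ψ ⟨b, h⟩ : ℝ) ^ 2 / 2) = -(1 / 2) * ∑ b : n, (if h : b = i₀ then -∑ k, ψ k else ψ ⟨b, h⟩ : ℝ) ^ 2 := by
      rw [Finset.mul_sum]; exact Finset.sum_congr rfl fun b _ => by ring
    have e2 : ∑ k : {i : n // i ≠ i₀}, -(2 / π ^ 2 * ψ k ^ 2) = -(2 / π ^ 2) * ∑ k, ψ k ^ 2 := by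
      rw [Finset.mul_sum]; exact Finset.sum_congr rfl fun k _ => by ring
    rw [e1, e2]
    have hπ : 2 / π ^ 2 ≤ 1 / 2 := by
      rw [div_le_div_iff₀ (by positivity) (by norm_num)]
      nlinarith [Real.pi_gt_three]
    have h0 : 0 ≤ ∑ k, ψ k ^ 2 := Finset.sum_nonneg fun k _ => sq_nonneg _
    nlinarith
  have hD := hasDerivAt_integral_of_dominated_loc_of_deriv_le (μ := (volume : Measure ({i : n // i ≠ i₀} → ℝ)))
    (x₀ := (1 : ℝ)) (F := F) (F' := F') (s := Set.Ioo (1 / 2 : ℝ) (3 / 2)) (Ioo_mem_nhds (by norm_num) (by norm_num))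
    (Eventually.of_forall fun t => (hcont t).aestronglyMeasurable) hint1 (hcont' 1).aestronglyMeasurable
    (Eventually.of_forall fun ψ t ht => hbound ψ t ht) (integrable_gaussPolyBound _ _)
    (Eventually.of_forall fun ψ t _ => hderiv ψ t)
  have h1N : 1 ≤ Fintype.card n := Fintype.card_pos_iff.2 ⟨i₀⟩
  have hscale : ∀ᶠ t : ℝ in 𝓝 1, ∫ ψ, F t ψ = M * (t ^ (-(((Fintype.card n : ℝ) ^ 2 - 1) / 2))) := by
    filter_upwards [Ioo_mem_nhds (show (1 / 2 : ℝ) < 1 by norm_num) (show (1 : ℝ) < 3 / 2 by norm_num)] with t ht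
    have ht0 : 0 < t := by linarith [ht.1]
    show (∫ ψ : {i : n // i ≠ i₀} → ℝ, Real.exp (∑ b : n, -(t * (if h : b = i₀ then -∑ k, ψ k else ψ ⟨b, h⟩ : ℝ) ^ 2 / 2)) * ∏ p : OD n, ((if h : p.1.1 = i₀ then -∑ k, ψ k else ψ ⟨p.1.1, h⟩ : ℝ) - (if h : p.1.2 = i₀ then -∑ k, ψ k else ψ ⟨p.1.2, h⟩ : ℝ)) ^ 2) = _
    rw [integral_suGaussVandermonde_scale i₀ ht0, hM.symm, Real.sqrt_eq_rpow, ← Real.rpow_natCast,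
      ← Real.rpow_mul ht0.le, Real.rpow_neg ht0.le, div_eq_mul_inv, Nat.cast_sub (Nat.one_le_pow 2 _ h1N)]
    congr 2
    push_cast
    ring
  have hD2 : HasDerivAt (fun t : ℝ => ∫ ψ, F t ψ) (M * (-(((Fintype.card n : ℝ) ^ 2 - 1) / 2))) 1 := by
    have h := (Real.hasDerivAt_rpow_const (x := (1 : ℝ)) (p := -(((Fintype.card n : ℝ) ^ 2 - 1) / 2))
      (Or.inl one_ne_zero)).const_mul M
    simp only [Real.one_rpow, mul_one] at h
    exact h.congr_of_eventuallyEq hscale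
  have huniq := hD.2.unique hD2
  have hF'1 : ∫ ψ, F' 1 ψ = -(1 / 2) * ∫ ψ : {i : n // i ≠ i₀} → ℝ, (∑ b : n, (if h : b = i₀ then -∑ k, ψ k else ψ ⟨b, h⟩ : ℝ) ^ 2) *
      (Real.exp (∑ b : n, -((if h : b = i₀ then -∑ k, ψ k else ψ ⟨b, h⟩ : ℝ) ^ 2 / 2)) * ∏ p : OD n, ((if h : p.1.1 = i₀ then -∑ k, ψ k else ψ ⟨p.1.1, h⟩ : ℝ) - (if h : p.1.2 = i₀ then -∑ k, ψ k else ψ ⟨p.1.2, h⟩ : ℝ)) ^ 2) := by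
    rw [← integral_const_mul]
    refine integral_congr_ae (Eventually.of_forall fun ψ => ?_)
    simp only [hF', one_mul]
    ring
  rw [hF'1] at huniq
  have : ∫ ψ : {i : n // i ≠ i₀} → ℝ, (∑ b : n, (if h : b = i₀ then -∑ k, ψ k else ψ ⟨b, h⟩ : ℝ) ^ 2) * (Real.exp (∑ b : n, -((if h : b = i₀ then -∑ k, ψ k else ψ ⟨b, h⟩ : ℝ) ^ 2 / 2)) *
      ∏ p : OD n, ((if h : p.1.1 = i₀ then -∑ k, ψ k else ψ ⟨p.1.1, h⟩ : ℝ) - (if h : p.1.2 = i₀ then -∑ k, ψ k else ψ ⟨p.1.2, h⟩ : ℝ)) ^ 2) = ((Fintype.card n : ℝ) ^ 2 - 1) * M := by linarith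
  rw [this]

end SU2nd

end Summit.Ventures.LatticeQCDFlow.Scoring
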